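import Literature.Probability.LatticeModels.PlanarIsingDiscApprox
import Literature.Probability.LatticeModels.PlanarIsingMeshTranslate
import HarnessLib

/-!
# `tendsto_chiPlusCorr` contradicts CHI: a slit at height `1/2` is visible only at even meshes

`Literature.Probability.LatticeModels.tendsto_chiPlusCorr` (`PlanarIsing.lean`) transcribes
Chelkak–Hongler–Izyurov, *Conformal invariance of spin correlations in the planar Ising model*,
Ann. of Math. 181 (2015) = arXiv:1202.2838 (CHI), Thm 1.1, as: for **every** admissible `Ω` and
all distinct `aᵢ ∈ Ω` the renormalised discrete correlations `δ^{-n/8} 𝔼⁺_{Ω_δ}[σ_{a₁}⋯σ_{aₙ}]`,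
computed on the tree's **fixed** discretisation `Ω_δ = meshDomain Ω δ`, converge as `δ → 0⁺`. CHI
prove convergence for discrete domains that *approximate* `Ω` ("`∂Ω_δ → ∂Ω` in the Hausdorff
sense", arXiv:1202.2838 §1.1 and §2.6; Thm 1.1: "`Ω_δ` discretizations of `Ω`"). The fixed scheme
need not approximate `Ω`, and — unlike the slit of irrational slope of `PlanarIsingSlitDisc.lean`,
which is invisible at every mesh and so does not obstruct mere *existence* of the limit — a slit at
**rational height** is resolved at some meshes and not at others. This file turns that observation
into a refutation of `tendsto_chiPlusCorr` relative to CHI's own theorem: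

* The axis-slit disc `Ω_A := 𝔻 ∖ ([1/4, 1) × {0})`, the unit disc slit along the positive real
  axis, written out as `Metric.ball 0 1 ∖ {z | z.im = 0 ∧ 1/4 ≤ z.re}` (this file introduces **no
  definitions**, only file-local notation): it is the rotation by `e^{-iπ/3}` of `SlitDisc.domain`,
  hence admissible (namespace `AxisSlitDisc`: `isAdmissibleDomain_domain`), with the explicit
  uniformising map `z ↦ SlitDisc.unif (e^{iπ/3} z)` onto `ℍ` (`isConformalBijection_unif`,
  `Im φ(0) = 4/5`, `|φ'(0)| = 5/2`). The axis slit contains mesh points of every lattice `δℤ²`, so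
  this domain *is* resolved by its discretisations at every mesh (CHI's hypothesis
  `MeshApproximates Ω_A`; its proof is the subject of the sequel `PlanarIsingAxisSlitApprox.lean`).
* Its translate `i/2 + Ω_A` (slit at height `1/2`) and the translated disc `i/2 + 𝔻`, marked at
  `b = i/2`.
  - At the meshes `δ = 1/(2m+1)` no lattice row has height `1/2`: the slit is invisible, the two
    translates have the same mesh vertices and the same closure, hence *identical* discrete `+`
    correlations (`meshIsingPlusCorr_translate_odd`, by the coincidence lemma
    `meshIsingPlusCorr_eq_of_closure_eq` of `PlanarIsingSlitDisc.lean`).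
  - At the meshes `δ = 1/(2(m+1))` the vector `i/2 = δ · (0, m+1)` is a lattice vector, and the
    discrete correlations are exactly those of the untranslated domains marked at `0`
    (`meshIsingPlusCorr_shiftVec_vadd`, by the lattice-translation covariance
    `meshIsingPlusCorr_vadd` of `PlanarIsingMeshTranslate.lean`).
* `not_tendsto_chiPlusCorr_of_limits`: consequently, if the renormalised magnetisations at `0` of
  the axis-slit disc and of the disc converge to **different** limits, `tendsto_chiPlusCorr` fails:
  it would give limits `ℓ₁`, `ℓ₂` for the two translates at `b`; along odd meshes `ℓ₁ = ℓ₂`, along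
  even meshes `ℓ₁ = lim (axis-slit disc at 0)` and `ℓ₂ = lim (disc at 0)`.
* `not_tendsto_chiPlusCorr_of_meshApproximates`: CHI Thm 1.3 (`k = 0`) with (1.2)–(1.3)
  (`chi_onePoint_rho`) and Wu's asymptotics (`wu_rhoCHI`, CHI Rem. 1.2 (iii)) give exactly such
  different limits, `𝒦 · (25/16)^{1/8}` and `𝒦` with `𝒦 = 2^{1/4} C₂^{1/2} > 0` (conformal radii
  `16/25` and `1`), for the disc by `meshApproximates_ball` and for the axis-slit disc granted
  `MeshApproximates Ω_A`, which is kept here as an explicit hypothesis (to be discharged in the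
  sequel `PlanarIsingAxisSlitApprox.lean`, giving `¬ tendsto_chiPlusCorr` from
  `chi_onePoint_rho ∧ wu_rhoCHI` alone).

Nothing here is a new named fact; all statements are proved. The corrected, CHI-faithful form of
`tendsto_chiPlusCorr` is `Literature.Probability.LatticeModels.tendsto_chiPlusCorr_of_hausdorff`
(`PlanarIsingOnePoint.lean`, hypothesis `MeshApproximates Ω`).

## References

* D. Chelkak, C. Hongler, K. Izyurov, *Conformal invariance of spin correlations in the planar
  Ising model*, Ann. of Math. (2) 181 (2015), 1087–1138; arXiv:1202.2838: §1.1 ("we are interested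
  in the setup when `Ω_δ` approximate some simply connected domain `Ω`"), Thm 1.1, Thm 1.3 with
  eqs. (1.2)–(1.3), Rem. 1.2 (iii), §2.6 ("approximates" = `∂Ω_δ → ∂Ω` Hausdorff).
* S. Friedli, Y. Velenik, *Statistical Mechanics of Lattice Systems*, CUP 2017, §3.1 (translation
  covariance of finite-volume Gibbs measures).
-/

noncomputable section

open scoped Pointwise
open Filter Metric Set Complex
open _root_.Topology
open Literature.Probability.LatticeModels

namespace Literature.Probability.LatticeModels

/-! ### Translates of admissible domains -/

/-- A translate of an admissible domain is admissible. [folklore] -/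
theorem isAdmissibleDomain_vadd {Ω : Set ℂ} (h : IsAdmissibleDomain Ω) (u : ℂ) :
    IsAdmissibleDomain (u +ᵥ Ω) :=
  ⟨h.1.vadd u, h.2.1.vadd u, h.2.2.1.vadd_set, (isSimplyConnected_vadd_set_iff).2 h.2.2.2⟩

/-! ### The axis-slit disc -/

namespace AxisSlitDisc

/-! Throughout, the axis slit is `{z : ℂ | z.im = 0 ∧ 1/4 ≤ z.re}`, the axis-slit disc is
`Ω_A := Metric.ball 0 1 ∖ {z | z.im = 0 ∧ 1/4 ≤ z.re}`, its uniformising map is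
`z ↦ SlitDisc.unif (SlitDisc.dir * z)` and the shift vector is `i/2 = ⟨0, 1/2⟩`; all four are written
out in full (no definitions and no notation are introduced). -/

/-- Rotation by `e^{iπ/3}` carries the axis slit onto the slit of `SlitDisc.domain`. [folklore] -/
theorem mul_dir_mem_slit_iff (z : ℂ) : SlitDisc.dir * z ∈ SlitDisc.slit ↔ z ∈ {z : ℂ | z.im = 0 ∧ 1 / 4 ≤ z.re} := by
  have h3 : Real.sqrt 3 * Real.sqrt 3 = 3 := Real.mul_self_sqrt (by norm_num)
  simp only [SlitDisc.slit, Set.mem_setOf_eq, SlitDisc.dir, Complex.mul_re, Complex.mul_im]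
  constructor
  · rintro ⟨h1, h2⟩
    have him : z.im = 0 := by linear_combination (1 / 2 : ℝ) * h1 - (z.im / 4) * h3
    refine ⟨him, ?_⟩
    rw [him] at h2
    linarith
  · rintro ⟨h1, h2⟩
    rw [h1]
    exact ⟨by ring, by linarith⟩

/-- The axis-slit disc is the preimage of `SlitDisc.domain` under the rotation `z ↦ e^{iπ/3} z`.
[folklore] -/
theorem mem_domain_iff (z : ℂ) : z ∈ (Metric.ball (0 : ℂ) 1 \ {z : ℂ | z.im = 0 ∧ 1 / 4 ≤ z.re}) ↔ SlitDisc.dir * z ∈ SlitDisc.domain := by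
  simp only [SlitDisc.domain, Set.mem_sdiff, mem_ball_zero_iff, norm_mul, SlitDisc.norm_dir,
    one_mul, mul_dir_mem_slit_iff]

/-- `e^{iπ/3} ≠ 0`. [folklore] -/
theorem dir_ne_zero : SlitDisc.dir ≠ 0 := fun h => by
  have := SlitDisc.norm_dir
  rw [h, norm_zero] at this
  exact zero_ne_one this

/-- The axis-slit disc as a preimage under the rotation homeomorphism. [folklore] -/
theorem domain_eq_preimage :
    (Metric.ball (0 : ℂ) 1 \ {z : ℂ | z.im = 0 ∧ 1 / 4 ≤ z.re}) = (Homeomorph.mulLeft₀ SlitDisc.dir dir_ne_zero) ⁻¹' SlitDisc.domain := by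
  ext z
  rw [mem_domain_iff, Set.mem_preimage, Homeomorph.coe_mulLeft₀]

/-- The axis-slit disc is open. [folklore] -/
theorem isOpen_domain : IsOpen (Metric.ball (0 : ℂ) 1 \ {z : ℂ | z.im = 0 ∧ 1 / 4 ≤ z.re}) := by
  rw [domain_eq_preimage]
  exact SlitDisc.isOpen_domain.preimage (Homeomorph.continuous _)

/-- The centre belongs to the axis-slit disc. [folklore] -/
theorem zero_mem_domain : (0 : ℂ) ∈ (Metric.ball (0 : ℂ) 1 \ {z : ℂ | z.im = 0 ∧ 1 / 4 ≤ z.re}) := by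
  rw [mem_domain_iff, mul_zero]
  exact SlitDisc.zero_mem_domain

/-- The axis-slit disc is simply connected (homeomorphic image of the slit disc). [folklore] -/
theorem isSimplyConnected_domain : IsSimplyConnected (Metric.ball (0 : ℂ) 1 \ {z : ℂ | z.im = 0 ∧ 1 / 4 ≤ z.re}) := by
  rw [domain_eq_preimage, Homeomorph.isSimplyConnected_preimage]
  exact SlitDisc.isAdmissibleDomain_domain.2.2.2

/-- The axis-slit disc is an admissible domain. [folklore] -/
theorem isAdmissibleDomain_domain : IsAdmissibleDomain (Metric.ball (0 : ℂ) 1 \ {z : ℂ | z.im = 0 ∧ 1 / 4 ≤ z.re}) :=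
  ⟨isOpen_domain, isBounded_ball.subset Set.sdiff_subset, ⟨0, zero_mem_domain⟩, isSimplyConnected_domain⟩

/-- The axis slit has empty interior. [folklore] -/
theorem interior_slit : interior {z : ℂ | z.im = 0 ∧ 1 / 4 ≤ z.re} = ∅ := by
  refine Set.eq_empty_of_subset_empty fun z hz => ?_
  have h1 : z ∈ interior {w : ℂ | w.im ≤ 0} := interior_mono (fun w hw => le_of_eq hw.1) hz
  have h2 : z ∈ interior {w : ℂ | 0 ≤ w.im} := interior_mono (fun w hw => ge_of_eq hw.1) hz
  rw [Complex.interior_setOf_im_le, Set.mem_setOf_eq] at h1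
  rw [Complex.interior_setOf_le_im, Set.mem_setOf_eq] at h2
  linarith

/-- The axis-slit disc and the disc have the same closure. [folklore] -/
theorem closure_domain : closure (Metric.ball (0 : ℂ) 1 \ {z : ℂ | z.im = 0 ∧ 1 / 4 ≤ z.re}) = closure (ball (0 : ℂ) 1) := by
  refine Set.Subset.antisymm (closure_mono Set.sdiff_subset) (closure_minimal ?_ isClosed_closure)
  have hd : Dense {z : ℂ | z.im = 0 ∧ 1 / 4 ≤ z.re}ᶜ := interior_eq_empty_iff_dense_compl.1 interior_slit
  simpa [Set.sdiff_eq] using hd.open_subset_closure_inter isOpen_ball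

/-- `e^{iπ/3} · e^{-iπ/3} = 1`. [folklore] -/
theorem dir_mul_conj_dir : SlitDisc.dir * starRingEnd ℂ SlitDisc.dir = 1 := by
  rw [mul_comm]; exact SlitDisc.conj_dir_mul_dir

/-- The rotation `z ↦ e^{iπ/3} z` is a bijection of the axis-slit disc onto `SlitDisc.domain`.
[folklore] -/
theorem bijOn_mul_dir : Set.BijOn (fun z => SlitDisc.dir * z) (Metric.ball (0 : ℂ) 1 \ {z : ℂ | z.im = 0 ∧ 1 / 4 ≤ z.re}) SlitDisc.domain := by
  refine ⟨fun z hz => (mem_domain_iff z).1 hz, fun z _ w _ h => mul_left_cancel₀ dir_ne_zero h,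
    fun w hw => ?_⟩
  refine ⟨starRingEnd ℂ SlitDisc.dir * w, ?_, ?_⟩
  · rw [mem_domain_iff, ← mul_assoc, dir_mul_conj_dir, one_mul]; exact hw
  · show SlitDisc.dir * (starRingEnd ℂ SlitDisc.dir * w) = w
    rw [← mul_assoc, dir_mul_conj_dir, one_mul]

/-- The uniformising map `z ↦ SlitDisc.unif (e^{iπ/3} z)` is a conformal bijection of the axis-slit
disc onto `ℍ`. [folklore] -/
theorem isConformalBijection_unif :
    IsConformalBijection (fun z : ℂ => SlitDisc.unif (SlitDisc.dir * z)) (Metric.ball (0 : ℂ) 1 \ {z : ℂ | z.im = 0 ∧ 1 / 4 ≤ z.re}) UpperHalfPlane.upperHalfPlaneSet := by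
  have hd : DifferentiableOn ℂ (fun z : ℂ => SlitDisc.dir * z) (Metric.ball (0 : ℂ) 1 \ {z : ℂ | z.im = 0 ∧ 1 / 4 ≤ z.re}) :=
    (differentiable_id.const_mul _).differentiableOn
  exact ⟨SlitDisc.isConformalBijection_unif.1.comp hd bijOn_mul_dir.mapsTo,
    SlitDisc.isConformalBijection_unif.2.comp bijOn_mul_dir⟩

/-- Its value at `0` is `SlitDisc.unif 0 = 4i/5`, of imaginary part `4/5`. [folklore] -/
theorem unif_zero_im : (SlitDisc.unif (SlitDisc.dir * 0)).im = 4 / 5 := by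
  rw [mul_zero]; exact SlitDisc.unif_zero_im

/-- Chain rule at `0`: `(SlitDisc.unif ∘ (e^{iπ/3} ·))' 0 = SlitDisc.unif' 0 · e^{iπ/3}`. [folklore] -/
theorem hasDerivAt_unif_zero :
    HasDerivAt (fun z : ℂ => SlitDisc.unif (SlitDisc.dir * z)) (5 / 4 * (2 * I * -(starRingEnd ℂ SlitDisc.dir)) * SlitDisc.dir) 0 := by
  have hA : HasDerivAt (fun z : ℂ => SlitDisc.dir * z) SlitDisc.dir 0 := by
    simpa using (hasDerivAt_id (0 : ℂ)).const_mul SlitDisc.dir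
  exact SlitDisc.hasDerivAt_unif_zero.comp_of_eq 0 hA (by simp)

/-- `|(SlitDisc.unif ∘ (e^{iπ/3} ·))' 0| = 5/2`. [folklore] -/
theorem norm_deriv_unif_zero : ‖deriv (fun z : ℂ => SlitDisc.unif (SlitDisc.dir * z)) 0‖ = 5 / 2 := by
  rw [hasDerivAt_unif_zero.deriv, norm_mul, ← SlitDisc.hasDerivAt_unif_zero.deriv,
    SlitDisc.norm_deriv_unif_zero, SlitDisc.norm_dir, mul_one]

/-! ### The shift by `i/2`: visible at even meshes, invisible at odd meshes -/

/-- At the even meshes `δ = 1/(2(m+1))` the shift `i/2 = δ · (0, m+1)` is a lattice vector.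
[folklore] -/
theorem meshPoint_even (m : ℕ) :
    meshPoint (1 / (2 * ((m : ℝ) + 1))) ![0, (m : ℤ) + 1] = (⟨0, 1 / 2⟩ : ℂ) := by
  apply Complex.ext
  · simp
  · rw [meshPoint_im]
    simp only [Matrix.cons_val_one, Matrix.cons_val_zero, Int.cast_add, Int.cast_natCast,
      Int.cast_one]
    field_simp

/-- **Even meshes: lattice translation.** For every domain `Ω`, at `δ = 1/(2(m+1))` the discrete
`+` magnetisation of `i/2 + Ω` at `i/2` equals that of `Ω` at `0` (translation covariance of the
discretisation and of the finite-volume `+` measures, `meshIsingPlusCorr_vadd`; Friedli–Velenik 2017,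
§3.1). [cite: FriedliVelenik2017, §3.1 and proof of Prop. 3.29 (translation covariance of finite-volume + measures)] -/
theorem meshIsingPlusCorr_shiftVec_vadd (Ω : Set ℂ) (m : ℕ) :
    meshIsingPlusCorr ((⟨0, 1 / 2⟩ : ℂ) +ᵥ Ω) (1 / (2 * ((m : ℝ) + 1))) ![(⟨0, 1 / 2⟩ : ℂ)] =
      meshIsingPlusCorr Ω (1 / (2 * ((m : ℝ) + 1))) ![0] := by
  have hδ : (1 / (2 * ((m : ℝ) + 1))) ≠ 0 := by positivity
  rw [← meshPoint_even m]
  have ha : (![meshPoint (1 / (2 * ((m : ℝ) + 1))) ![0, (m : ℤ) + 1]] : Fin 1 → ℂ) =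
      fun i => (![0] : Fin 1 → ℂ) i + meshPoint (1 / (2 * ((m : ℝ) + 1))) ![0, (m : ℤ) + 1] := by
    funext i
    fin_cases i
    simp
  rw [ha]
  exact meshIsingPlusCorr_vadd hδ _ ![0]

/-- **Odd meshes: the slit at height `1/2` is invisible.** At `δ = 1/(2m+1)` no mesh point has
imaginary part `1/2`, so the translates by `i/2` of the axis-slit disc and of the disc have the same
mesh vertices. [folklore] -/
theorem meshVertices_shiftVec_vadd_odd (m : ℕ) :
    meshVertices ((⟨0, 1 / 2⟩ : ℂ) +ᵥ (Metric.ball (0 : ℂ) 1 \ {z : ℂ | z.im = 0 ∧ 1 / 4 ≤ z.re})) (1 / (2 * (m : ℝ) + 1)) =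
      meshVertices ((⟨0, 1 / 2⟩ : ℂ) +ᵥ ball (0 : ℂ) 1) (1 / (2 * (m : ℝ) + 1)) := by
  ext x
  simp only [mem_meshVertices_iff, Set.mem_vadd_set_iff_neg_vadd_mem, Set.mem_sdiff,
    and_iff_left_iff_imp]
  intro _ hs
  have him := hs.1
  rw [vadd_eq_add, Complex.add_im, Complex.neg_im, meshPoint_im] at him
  have hm : (0 : ℝ) < 2 * (m : ℝ) + 1 := by positivity
  have h2 : (2 * x 1 : ℝ) = 2 * (m : ℝ) + 1 := by
    field_simp at him
    linarith
  have h3 : (2 * x 1 : ℤ) = 2 * (m : ℤ) + 1 := by exact_mod_cast h2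
  omega

/-- The two translates have the same closure (the closed disc shifted by `i/2`). [folklore] -/
theorem closure_shiftVec_vadd :
    closure ((⟨0, 1 / 2⟩ : ℂ) +ᵥ (Metric.ball (0 : ℂ) 1 \ {z : ℂ | z.im = 0 ∧ 1 / 4 ≤ z.re})) = closure ((⟨0, 1 / 2⟩ : ℂ) +ᵥ ball (0 : ℂ) 1) := by
  rw [closure_vadd, closure_vadd, closure_domain]

/-- **Odd meshes: identical discrete correlations.** At `δ = 1/(2m+1)` the discrete `+`
correlations of `i/2 + AxisSlitDisc.domain` and of `i/2 + 𝔻` coincide (same closure, both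
bounded, same mesh vertices: coincidence lemma `meshIsingPlusCorr_eq_of_closure_eq`). [folklore] -/
theorem meshIsingPlusCorr_translate_odd (m : ℕ) {n : ℕ} (a : Fin n → ℂ) :
    meshIsingPlusCorr ((⟨0, 1 / 2⟩ : ℂ) +ᵥ (Metric.ball (0 : ℂ) 1 \ {z : ℂ | z.im = 0 ∧ 1 / 4 ≤ z.re})) (1 / (2 * (m : ℝ) + 1)) a =
      meshIsingPlusCorr ((⟨0, 1 / 2⟩ : ℂ) +ᵥ ball (0 : ℂ) 1) (1 / (2 * (m : ℝ) + 1)) a :=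
  meshIsingPlusCorr_eq_of_closure_eq closure_shiftVec_vadd
    ⟨fun _ => isBounded_ball.vadd _, fun _ => (isBounded_ball.subset Set.sdiff_subset).vadd _⟩
    (meshVertices_shiftVec_vadd_odd m) a

/-! ### The refutation -/

/-- The even meshes `1/(2(m+1)) → 0⁺`. [folklore] -/
theorem tendsto_even_mesh :
    Tendsto (fun m : ℕ => 1 / (2 * ((m : ℝ) + 1))) atTop (𝓝[>] 0) := by
  refine tendsto_nhdsWithin_iff.2 ⟨?_, Eventually.of_forall fun m => ?_⟩
  · exact tendsto_const_nhds.div_atTop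
      ((tendsto_atTop_add_const_right _ 1 tendsto_natCast_atTop_atTop).const_mul_atTop two_pos)
  · show (0 : ℝ) < 1 / (2 * ((m : ℝ) + 1))
    positivity

/-- The odd meshes `1/(2m+1) → 0⁺`. [folklore] -/
theorem tendsto_odd_mesh :
    Tendsto (fun m : ℕ => 1 / (2 * (m : ℝ) + 1)) atTop (𝓝[>] 0) := by
  refine tendsto_nhdsWithin_iff.2 ⟨?_, Eventually.of_forall fun m => ?_⟩
  · exact tendsto_const_nhds.div_atTop
      (tendsto_atTop_add_const_right _ 1 (tendsto_natCast_atTop_atTop.const_mul_atTop two_pos))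
  · show (0 : ℝ) < 1 / (2 * (m : ℝ) + 1)
    positivity

/-- `i/2` belongs to the translate by `i/2` of any set containing `0`. [folklore] -/
theorem shiftVec_mem_vadd {Ω : Set ℂ} (h : (0 : ℂ) ∈ Ω) : (⟨0, 1 / 2⟩ : ℂ) ∈ (⟨0, 1 / 2⟩ : ℂ) +ᵥ Ω := by
  have := Set.vadd_mem_vadd_set (a := (⟨0, 1 / 2⟩ : ℂ)) h
  simpa using this

/-- **`tendsto_chiPlusCorr` is incompatible with distinct limits for the axis-slit disc and the
disc.** If the renormalised `+` magnetisations at the centre, `δ^{-1/8} 𝔼⁺_{Ω_δ}[σ_0]`, of the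
axis-slit disc `𝔻 ∖ [1/4, 1)` and of the disc `𝔻` converge as `δ → 0⁺` to limits `ℓ_A ≠ ℓ_D`, then
`tendsto_chiPlusCorr` is false. Indeed it would provide limits `ℓ₁`, `ℓ₂` of the magnetisations at
`i/2` of the translates `i/2 + (𝔻 ∖ [1/4,1))` and `i/2 + 𝔻`; along the odd meshes `1/(2m+1)` the
two discrete magnetisations coincide (`meshIsingPlusCorr_translate_odd`), so `ℓ₁ = ℓ₂`, while along
the even meshes `1/(2(m+1))` they are the magnetisations at `0` of the untranslated domains
(`meshIsingPlusCorr_shiftVec_vadd`), so `ℓ₁ = ℓ_A` and `ℓ₂ = ℓ_D`. (CHI, arXiv:1202.2838, §1.1 and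
§2.6: the theorems concern discretisations *approximating* `Ω`; the fixed scheme `meshDomain` resolves
the slit at height `1/2` only at even meshes.) [cite: ChelkakHonglerIzyurovAnnals2015, §1.1 and §2.6 (approximation hypothesis), Thm. 1.1] -/
theorem not_tendsto_chiPlusCorr_of_limits {ℓA ℓD : ℝ}
    (hA : Tendsto (fun δ : ℝ => δ ^ (-(1 : ℝ) / 8) * meshIsingPlusCorr (Metric.ball (0 : ℂ) 1 \ {z : ℂ | z.im = 0 ∧ 1 / 4 ≤ z.re}) δ ![0]) (𝓝[>] 0)
      (𝓝 ℓA))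
    (hD : Tendsto (fun δ : ℝ => δ ^ (-(1 : ℝ) / 8) * meshIsingPlusCorr (ball (0 : ℂ) 1) δ ![0])
      (𝓝[>] 0) (𝓝 ℓD))
    (hne : ℓA ≠ ℓD) : ¬ tendsto_chiPlusCorr := by
  intro H
  have hinj : Function.Injective (![(⟨0, 1 / 2⟩ : ℂ)] : Fin 1 → ℂ) := Function.injective_of_subsingleton _
  have H1 : Tendsto (fun δ : ℝ => δ ^ (-(1 : ℝ) / 8) *
      meshIsingPlusCorr ((⟨0, 1 / 2⟩ : ℂ) +ᵥ (Metric.ball (0 : ℂ) 1 \ {z : ℂ | z.im = 0 ∧ 1 / 4 ≤ z.re})) δ ![(⟨0, 1 / 2⟩ : ℂ)]) (𝓝[>] 0)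
      (𝓝 (chiPlusCorr ((⟨0, 1 / 2⟩ : ℂ) +ᵥ (Metric.ball (0 : ℂ) 1 \ {z : ℂ | z.im = 0 ∧ 1 / 4 ≤ z.re})) 1 ![(⟨0, 1 / 2⟩ : ℂ)])) := by
    have := H (isAdmissibleDomain_vadd isAdmissibleDomain_domain (⟨0, 1 / 2⟩ : ℂ)) (n := 1)
      (a := ![(⟨0, 1 / 2⟩ : ℂ)]) hinj (fun i => by fin_cases i; exact shiftVec_mem_vadd zero_mem_domain)
    simpa only [Nat.cast_one] using this
  have H2 : Tendsto (fun δ : ℝ => δ ^ (-(1 : ℝ) / 8) *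
      meshIsingPlusCorr ((⟨0, 1 / 2⟩ : ℂ) +ᵥ ball (0 : ℂ) 1) δ ![(⟨0, 1 / 2⟩ : ℂ)]) (𝓝[>] 0)
      (𝓝 (chiPlusCorr ((⟨0, 1 / 2⟩ : ℂ) +ᵥ ball (0 : ℂ) 1) 1 ![(⟨0, 1 / 2⟩ : ℂ)])) := by
    have := H (isAdmissibleDomain_vadd SlitDisc.isAdmissibleDomain_ball (⟨0, 1 / 2⟩ : ℂ)) (n := 1)
      (a := ![(⟨0, 1 / 2⟩ : ℂ)]) hinj
      (fun i => by fin_cases i; exact shiftVec_mem_vadd (mem_ball_self one_pos))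
    simpa only [Nat.cast_one] using this
  -- even meshes: the limits are those of the untranslated domains at `0`
  have e1 : chiPlusCorr ((⟨0, 1 / 2⟩ : ℂ) +ᵥ (Metric.ball (0 : ℂ) 1 \ {z : ℂ | z.im = 0 ∧ 1 / 4 ≤ z.re})) 1 ![(⟨0, 1 / 2⟩ : ℂ)] = ℓA := by
    refine tendsto_nhds_unique (H1.comp tendsto_even_mesh) ?_
    have heq : ((fun δ : ℝ => δ ^ (-(1 : ℝ) / 8) *
        meshIsingPlusCorr ((⟨0, 1 / 2⟩ : ℂ) +ᵥ (Metric.ball (0 : ℂ) 1 \ {z : ℂ | z.im = 0 ∧ 1 / 4 ≤ z.re})) δ ![(⟨0, 1 / 2⟩ : ℂ)]) ∘ fun m : ℕ =>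
          1 / (2 * ((m : ℝ) + 1))) =
        ((fun δ : ℝ => δ ^ (-(1 : ℝ) / 8) * meshIsingPlusCorr (Metric.ball (0 : ℂ) 1 \ {z : ℂ | z.im = 0 ∧ 1 / 4 ≤ z.re}) δ ![0]) ∘ fun m : ℕ =>
          1 / (2 * ((m : ℝ) + 1))) := by
      funext m
      simp only [Function.comp_apply, meshIsingPlusCorr_shiftVec_vadd]
    rw [heq]
    exact hA.comp tendsto_even_mesh
  have e2 : chiPlusCorr ((⟨0, 1 / 2⟩ : ℂ) +ᵥ ball (0 : ℂ) 1) 1 ![(⟨0, 1 / 2⟩ : ℂ)] = ℓD := by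
    refine tendsto_nhds_unique (H2.comp tendsto_even_mesh) ?_
    have heq : ((fun δ : ℝ => δ ^ (-(1 : ℝ) / 8) *
        meshIsingPlusCorr ((⟨0, 1 / 2⟩ : ℂ) +ᵥ ball (0 : ℂ) 1) δ ![(⟨0, 1 / 2⟩ : ℂ)]) ∘ fun m : ℕ =>
          1 / (2 * ((m : ℝ) + 1))) =
        ((fun δ : ℝ => δ ^ (-(1 : ℝ) / 8) * meshIsingPlusCorr (ball (0 : ℂ) 1) δ ![0]) ∘
          fun m : ℕ => 1 / (2 * ((m : ℝ) + 1))) := by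
      funext m
      simp only [Function.comp_apply, meshIsingPlusCorr_shiftVec_vadd]
    rw [heq]
    exact hD.comp tendsto_even_mesh
  -- odd meshes: the two translates have identical discrete correlations
  have e3 : chiPlusCorr ((⟨0, 1 / 2⟩ : ℂ) +ᵥ (Metric.ball (0 : ℂ) 1 \ {z : ℂ | z.im = 0 ∧ 1 / 4 ≤ z.re})) 1 ![(⟨0, 1 / 2⟩ : ℂ)] =
      chiPlusCorr ((⟨0, 1 / 2⟩ : ℂ) +ᵥ ball (0 : ℂ) 1) 1 ![(⟨0, 1 / 2⟩ : ℂ)] := by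
    refine tendsto_nhds_unique (H1.comp tendsto_odd_mesh) ?_
    have heq : ((fun δ : ℝ => δ ^ (-(1 : ℝ) / 8) *
        meshIsingPlusCorr ((⟨0, 1 / 2⟩ : ℂ) +ᵥ (Metric.ball (0 : ℂ) 1 \ {z : ℂ | z.im = 0 ∧ 1 / 4 ≤ z.re})) δ ![(⟨0, 1 / 2⟩ : ℂ)]) ∘ fun m : ℕ =>
          1 / (2 * (m : ℝ) + 1)) =
        ((fun δ : ℝ => δ ^ (-(1 : ℝ) / 8) *
          meshIsingPlusCorr ((⟨0, 1 / 2⟩ : ℂ) +ᵥ ball (0 : ℂ) 1) δ ![(⟨0, 1 / 2⟩ : ℂ)]) ∘ fun m : ℕ =>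
            1 / (2 * (m : ℝ) + 1)) := by
      funext m
      simp only [Function.comp_apply, meshIsingPlusCorr_translate_odd]
    rw [heq]
    exact H2.comp tendsto_odd_mesh
  exact hne (e1.symm.trans (e3.trans e2))

/-- **`tendsto_chiPlusCorr` contradicts CHI Thm 1.3 (`k = 0`) + Wu, granted that the axis-slit disc
is approximated by its discretisations.** Under `chi_onePoint_rho` (CHI Thm 1.3, `k = 0`, with
(1.2)–(1.3)) and `wu_rhoCHI` (CHI Rem. 1.2 (iii)), the renormalised magnetisation at `0` converges to
`𝒦 · |φ'(0)|^{1/8} (2 Im φ 0)^{-1/8}`, `𝒦 = 2^{1/4} C₂^{1/2} > 0`, for every admissible domain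
satisfying `MeshApproximates` and every conformal bijection `φ` onto `ℍ` (`tendsto_onePoint_of_rho`):
for the disc (`meshApproximates_ball`, inverse Cayley transform: `φ 0 = i`, `|φ' 0| = 2`) this is
`𝒦`, for the axis-slit disc (`φ z = SlitDisc.unif (e^{iπ/3} z)`: `Im φ 0 = 4/5`, `|φ' 0| = 5/2`)
it is `𝒦 · (25/16)^{1/8} ≠ 𝒦`. Hence `not_tendsto_chiPlusCorr_of_limits` applies. The hypothesis
`MeshApproximates Ω_A` (the axis-slit disc is approximated by its discretisations: the axis slit
carries mesh points of every `δℤ²`) is kept explicit here; it is the subject of the sequel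
`PlanarIsingAxisSlitApprox.lean`. [cite: ChelkakHonglerIzyurovAnnals2015, Thm. 1.3 (k = 0) with eqs. (1.2)–(1.3) and Rem. 1.2 (iii); §1.1, §2.6] -/
theorem not_tendsto_chiPlusCorr_of_meshApproximates (hM : MeshApproximates (Metric.ball (0 : ℂ) 1 \ {z : ℂ | z.im = 0 ∧ 1 / 4 ≤ z.re}))
    (h₁ : chi_onePoint_rho) (h₂ : wu_rhoCHI) : ¬ tendsto_chiPlusCorr := by
  obtain ⟨C₂, hC₂, hρ⟩ := h₂
  have hD := tendsto_onePoint_of_rho (h₁ _ SlitDisc.isAdmissibleDomain_ball meshApproximates_ball _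
    SlitDisc.isConformalBijection_cayleyInvFun 0 (mem_ball_self one_pos)) hC₂ hρ
  have hA := tendsto_onePoint_of_rho (h₁ _ isAdmissibleDomain_domain hM _
    isConformalBijection_unif 0 zero_mem_domain) hC₂ hρ
  refine not_tendsto_chiPlusCorr_of_limits hA hD ?_
  have e1 : ‖deriv RandomPlanarGeometry.cayleyInvFun 0‖ = 2 := by
    rw [SlitDisc.deriv_cayleyInvFun_zero, norm_mul, Complex.norm_I, mul_one]; simp
  have e2 : (RandomPlanarGeometry.cayleyInvFun 0).im = 1 := by
    rw [SlitDisc.cayleyInvFun_zero, Complex.I_im]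
  rw [e1, e2, norm_deriv_unif_zero, unif_zero_im, show (2 : ℝ) * 1 = 2 by norm_num,
    show (2 : ℝ) * (4 / 5) = 8 / 5 by norm_num]
  have hK : 0 < (2 : ℝ) ^ ((1 : ℝ) / 4) * C₂ ^ ((1 : ℝ) / 2) := by positivity
  have key : (2 : ℝ) ^ ((1 : ℝ) / 8) * (2 : ℝ) ^ (-(1 : ℝ) / 8) = 1 := by
    rw [← Real.rpow_add two_pos]; norm_num
  have key' : (5 / 2 : ℝ) ^ ((1 : ℝ) / 8) * (8 / 5 : ℝ) ^ (-(1 : ℝ) / 8) =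
      (25 / 16 : ℝ) ^ ((1 : ℝ) / 8) := by
    rw [show (-(1 : ℝ) / 8) = -((1 : ℝ) / 8) by ring, Real.rpow_neg (by norm_num),
      ← Real.inv_rpow (by norm_num), ← Real.mul_rpow (by norm_num) (by norm_num)]
    norm_num
  have hgt : (1 : ℝ) < (25 / 16 : ℝ) ^ ((1 : ℝ) / 8) :=
    Real.one_lt_rpow (by norm_num) (by norm_num)
  rw [mul_assoc ((2 : ℝ) ^ ((1 : ℝ) / 4) * C₂ ^ ((1 : ℝ) / 2)), key',
    mul_assoc ((2 : ℝ) ^ ((1 : ℝ) / 4) * C₂ ^ ((1 : ℝ) / 2)), key, mul_one]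
  intro h
  have hx : (25 / 16 : ℝ) ^ ((1 : ℝ) / 8) = 1 := mul_left_cancel₀ hK.ne' (h.trans (mul_one _).symm)
  exact absurd hx hgt.ne'

end AxisSlitDisc

end Literature.Probability.LatticeModels
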